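/-
Copyright (c) 2026. All rights reserved.
Released under Apache 2.0 license as described in the file LICENSE.
Authors: abc-iut cell, prover seat abc-iut-L4-t5 (wave 2, gen 8), over the reductions of abc-iut-w5-d097
(`LogFrobeniusNotSimCompatOfObstruction.lean`) and abc-iut-w4-d095 (`LogFrobeniusNotSimCompatArchTSOfObstruction.lean`,
`LogFrobeniusLogWallArchOrigin.lean`) and the statements of abc-iut-L4-t3 (`LogFrobeniusObservables.lean`,
`LogFrobeniusIncompatibility.lean`).
-/
import Literature.AnabelianGeometry.AbsoluteAnabelian.LogFrobeniusNotSimCompatArchTSOfObstruction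
import HarnessLib

/-!
# [AbsTopIII] Corollary 5.5 (iv), second sentence, for EVERY `TS`-datum at an archimedean place

S. Mochizuki, *Topics in absolute anabelian geometry III: global reconstruction algorithms*, J. Math. Sci. Univ.
Tokyo 22 (2015) 939–1156 [MochizukiAbsTopIII2015]; locators = pages of the author's manuscript
(`paper:url-5493eb38cbb7`), read on the page: Def 5.4 (v) p. 127 (the archimedean graph `Γ⃗^log_v`:
`k~ →(id) k~ ↠ k^× ↪ k`, "we shall refer … to `Γ⃗^log_v` itself as `Γ⃗^⋉_v`"), Def 5.4 (vii) p. 128 ("`ε` an edge of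
`Γ⃗^⋉_v` (respectively, `Γ⃗^log_v`) … `ι⊞_{v,ε}` (respectively, `ι_{v,ε}`)"), Cor 5.5 (iv) p. 131 (second sentence:
"the telecore structure `𝔗_{An•}` of (ii), the contact structure `ℋ_{An•}` of (ii), and the observables `S_log`,
`S_log⊞` of (iii) are not simultaneously compatible"), proof pp. 132–133.

PROOF-ONLY companion (no new notion, no named `Prop`).  State of the tree before this file: the FIRST sentence of
Cor 5.5 (iv) in its print-faithful form `Cor55LogWall T` is closed at the setting with genuine archimedean
components `archGenuine 𝔄` for EVERY `TS`-valued homotopy datum `T` (`archGenuine_cor55LogWall`, abc-iut-w4-d095),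
whereas the SECOND sentence `Cor55NotSimultaneouslyCompatible T` was closed there only at the setting's own datum
`archGenuineTS` (`archGenuine_cor55NotSimultaneouslyCompatible_TS`), because both reductions of the second sentence
(abc-iut-w5-d097's two-path obstruction, abc-iut-w4-d095's archimedean cycle) read the `TS`-observable `S_log`, whose
homotopies `ι_{v,ε}` ARE the datum `T`.  The gap is formal: by Def 5.4 (v) the archimedean graph `Γ⃗^log_v` IS
`Γ⃗^⋉_v` (in the tree: `LogEdge true = ArchEdge = LogEdgeTS true`, `LogEdge.toTS` the identity), and the interface
`TSHomotopies` pins `ι_{v,ε} = ι⊞_{v,ε}` pushed down to `𝒩_v` on `Γ⃗^⋉_v` (`TSHomotopies.iota_toTS`).  Hence: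
* §1 — at an archimedean place every `TS`-datum is DETERMINED by the setting (`TSHomotopies.exists_iota_eq_whiskerRight`,
  `TSHomotopies.iota_eq_iota_of_isArc`); over an index set all of whose places are archimedean the datum is unique
  (`TSHomotopies.subsingleton_of_forall_isArc`);
* §2 — a `T`-FREE print-shaped criterion for the second sentence at any setting with an archimedean place
  (`cor55NotSimCompat_of_iota_spaceLink_not_surjective`: the hypothesis is on the setting's own `ι⊞_{v₀,ε}` along
  `k^× ↪ k`, observed in `𝒩_{v₀}`), and ONE such input yielding BOTH sentences of Cor 5.5 (iv) for EVERY `T`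
  (`cor55iv_of_iota_spaceLink_not_surjective`; first sentence through abc-iut-L4-t3's `cor55LogWall_of_incompatibility`
  and abc-iut-w4-d095's `cor55Incompatibility_of_iota_spaceLink_not_surjective`);
* §3 — at `archGenuine 𝔄` (arithmetic datum `k^× ↪ k` misses `0`): the second sentence for EVERY `TS`-datum `T`
  (`archGenuine_cor55NotSimultaneouslyCompatible`), both sentences for every `T` (`archGenuine_cor55iv`), binders =
  {one archimedean place `v₀`, one `TF`-pair `x₀`}, no named fact; existence form `exists_setting_forall_cor55iv`.
MODEL-LEVEL where §3 is concerned (module docstring of `LogFrobeniusLogWallArchOrigin.lean`: at `archGenuine 𝔄` the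
archimedean components are print's, the nonarchimedean components and the mono-analytic side are placeholders — none of
which Cor 5.5 (iv) reads at an archimedean place).  At a NONARCHIMEDEAN place the space-link arrow `k̄^× ↪ k̄` is not an
edge of `Γ⃗^⋉_v`, so there `ι_{v,ε}` is honest extra data and the tree's closures at the genuine nonarchimedean settings
(`nonarchGenuine_cor55LogWall_and_notSimCompat` and its `Mono`/`Over`/`Slim` twins) are, print-faithfully, at each
setting's own datum.

Refereed pre-IUT material; OUR kernel check of typed statements; nothing here bears on [IUTchIII] Cor. 3.12; no side
taken; typed ≠ proved; model-level ≠ node-level.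
-/

set_option autoImplicit false

universe w u

open CategoryTheory

namespace Literature.AnabelianGeometry.AbsoluteAnabelian

/-! ## §1. At an archimedean place `Γ⃗^log_v = Γ⃗^⋉_v`: every `TS`-datum is determined by the setting -/

/-- At an archimedean place every edge of `Γ⃗^log_v` is an edge of `Γ⃗^⋉_v` (Def 5.4 (v): "we shall refer … to
`Γ⃗^log_v` itself as `Γ⃗^⋉_v`"): `LogEdge.toTS` is onto — indeed the identity — for `b = true`.  Stated for a Boolean
`b = true` so that it applies to `b := isArc v` without transport. [cite: MochizukiAbsTopIII2015, Def 5.4 (v) p. 127] -/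
theorem LogEdge.exists_toTS_eq_of_eq_true :
    ∀ (b : Bool) (_ : b = true) {ν₁ ν₂ : LogVertex b} (ε : LogEdgeTS b ν₁ ν₂), ∃ ε' : LogEdge b ν₁ ν₂, ε'.toTS = ε
  | true, _, _, _, ε => ⟨ε, rfl⟩

namespace LogFrobeniusSetting

variable {Vmod : Type u} {isArc : Vmod → Bool} (L : LogFrobeniusSetting Vmod isArc)

namespace TSHomotopies

/-- **At an archimedean place `v`, every `ι_{v,ε}` of a `TS`-datum is `ι⊞_{v,ε}` pushed down to `𝒩_v`** (Def 5.4 (vii)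
read with Def 5.4 (v): there is no edge of `Γ⃗^log_v` outside `Γ⃗^⋉_v`). [cite: MochizukiAbsTopIII2015, Def 5.4 (vii) p. 128] -/
theorem exists_iota_eq_whiskerRight (T : L.TSHomotopies) (v : Vmod) (hv : isArc v = true)
    {ν₁ ν₂ : LogVertex (isArc v)} (ε : LogEdgeTS (isArc v) ν₁ ν₂) :
    ∃ ε' : LogEdge (isArc v) ν₁ ν₂, ε'.toTS = ε ∧ T.iota v ε = Functor.whiskerRight (L.iota v ε') (L.forget v) := by
  obtain ⟨ε', rfl⟩ := LogEdge.exists_toTS_eq_of_eq_true (isArc v) hv ε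
  exact ⟨ε', rfl, T.iota_toTS v ε'⟩

/-- Componentwise form: at an archimedean place `v` and an object `x₀` of `𝒳`, the `x₀`-component of `ι_{v,ε}` is
`(𝒩⊞_v → 𝒩_v)` applied to the `x₀`-component of `ι⊞_{v,ε}`. [cite: MochizukiAbsTopIII2015, Def 5.4 (vii) p. 128] -/
theorem exists_iota_app_eq (T : L.TSHomotopies) (v : Vmod) (hv : isArc v = true)
    {ν₁ ν₂ : LogVertex (isArc v)} (ε : LogEdgeTS (isArc v) ν₁ ν₂) (x₀ : L.X) :
    ∃ ε' : LogEdge (isArc v) ν₁ ν₂, ε'.toTS = ε ∧ (T.iota v ε).app x₀ = (L.forget v).map ((L.iota v ε').app x₀) := by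
  obtain ⟨ε', hε', hι⟩ := exists_iota_eq_whiskerRight L T v hv ε
  exact ⟨ε', hε', by rw [hι, Functor.whiskerRight_app]⟩

/-- **Any two `TS`-data agree at every archimedean place.** [cite: MochizukiAbsTopIII2015, Def 5.4 (vii) p. 128] -/
theorem iota_eq_iota_of_isArc (T T' : L.TSHomotopies) (v : Vmod) (hv : isArc v = true)
    {ν₁ ν₂ : LogVertex (isArc v)} (ε : LogEdgeTS (isArc v) ν₁ ν₂) : T.iota v ε = T'.iota v ε := by
  obtain ⟨ε', rfl⟩ := LogEdge.exists_toTS_eq_of_eq_true (isArc v) hv ε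
  rw [T.iota_toTS v ε', T'.iota_toTS v ε']

/-- Two `TS`-data with the same `ι_{v,ε}` are equal: the interface of Def 5.4 (vii), `TS`-half, consists of the
`ι_{v,ε}` alone (its second field is a proposition). [cite: MochizukiAbsTopIII2015, Def 5.4 (vii) p. 128] -/
theorem ext_iota {T T' : L.TSHomotopies} (h : ∀ (v : Vmod) {ν₁ ν₂ : LogVertex (isArc v)}
    (ε : LogEdgeTS (isArc v) ν₁ ν₂), T.iota v ε = T'.iota v ε) : T = T' := by
  cases T with
  | mk ι hι =>
    cases T' with
    | mk ι' hι' =>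
      have hιι' : @ι = @ι' := by
        funext v ν₁ ν₂ ε
        exact h v ε
      cases hιι'
      rfl

/-- **Over an index set all of whose places are archimedean, a setting carries at most one `TS`-datum** (Def 5.4 (vii)
pins `ι_{v,ε}` on `Γ⃗^⋉_v = Γ⃗^log_v` at every `v`). [cite: MochizukiAbsTopIII2015, Def 5.4 (vii) p. 128] -/
theorem subsingleton_of_forall_isArc (hV : ∀ v : Vmod, isArc v = true) : Subsingleton L.TSHomotopies :=
  ⟨fun T T' => ext_iota L (fun v _ _ ε => iota_eq_iota_of_isArc L T T' v (hV v) ε)⟩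

end TSHomotopies

/-! ## §2. The `T`-free print-shaped criterion for the second sentence, and one input for both sentences -/

/-- **[AbsTopIII] Cor 5.5 (iv), second sentence, from the non-surjectivity of print's `k^× ↪ k` — with NO hypothesis
on the `TS`-datum.**  For any setting `L`, any `TS`-datum `T`, an archimedean place `v₀`, an object `x₀` of `𝒳` and a
set-valued functor `Φ` on `𝒩_{v₀}`: if for every `ι⊞`-edge `ε` from a pre-log vertex into the space-link vertex the
`x₀`-component of `ι⊞_{v₀,ε}`, pushed down to `𝒩_{v₀}`, is not surjective under `Φ` (at an archimedean place: the
natural inclusion `k^× ↪ k` of Def 5.4 (v) misses `0`), then `𝔗_{An•}`, `ℋ_{An•}`, `S_log`, `S_log⊞` are not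
simultaneously compatible.  (abc-iut-w4-d095's `cor55NotSimCompat_of_iotaTS_spaceLink_not_surjective` with its
hypothesis on `ι_{v₀,ε}` discharged by §1.) [cite: MochizukiAbsTopIII2015, Cor 5.5 (iv) p. 131] -/
theorem cor55NotSimCompat_of_iota_spaceLink_not_surjective (T : L.TSHomotopies) (v₀ : Vmod)
    (hv₀ : isArc v₀ = true) (x₀ : L.X) (Φ : L.N v₀ ⥤ Type w)
    (hΦ : ∀ (ν : LogVertex (isArc v₀)), ν.isPostLog = false →
      ∀ ε : LogEdge (isArc v₀) ν (LogVertex.spaceLink (isArc v₀)),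
        ¬ Function.Surjective (Φ.map ((L.forget v₀).map ((L.iota v₀ ε).app x₀)) : _ → _)) :
    L.Cor55NotSimultaneouslyCompatible T := by
  refine L.cor55NotSimCompat_of_iotaTS_spaceLink_not_surjective T v₀ hv₀ x₀ Φ ?_
  intro ν hν ε
  obtain ⟨ε', _, hι⟩ := TSHomotopies.exists_iota_app_eq L T v₀ hv₀ ε x₀
  rw [hι]
  exact hΦ ν hν ε'

/-- **ONE print-shaped input at an archimedean place yields BOTH sentences of [AbsTopIII] Cor 5.5 (iv) for EVERY
`TS`-datum**: the first sentence (`Cor55LogWall T`, via abc-iut-L4-t3's `cor55LogWall_of_incompatibility` and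
abc-iut-w4-d095's `cor55Incompatibility_of_iota_spaceLink_not_surjective` applied to `Φ⊞ := (𝒩⊞_{v₀} → 𝒩_{v₀}) ⋙ Φ`)
and the second sentence (`cor55NotSimCompat_of_iota_spaceLink_not_surjective`). [cite: MochizukiAbsTopIII2015, Cor 5.5 (iv) p. 131] -/
theorem cor55iv_of_iota_spaceLink_not_surjective (v₀ : Vmod) (hv₀ : isArc v₀ = true) (x₀ : L.X)
    (Φ : L.N v₀ ⥤ Type w)
    (hΦ : ∀ (ν : LogVertex (isArc v₀)), ν.isPostLog = false →
      ∀ ε : LogEdge (isArc v₀) ν (LogVertex.spaceLink (isArc v₀)),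
        ¬ Function.Surjective (Φ.map ((L.forget v₀).map ((L.iota v₀ ε).app x₀)) : _ → _))
    (T : L.TSHomotopies) :
    L.Cor55LogWall T ∧ L.Cor55NotSimultaneouslyCompatible T :=
  ⟨L.cor55LogWall_of_incompatibility T
      (L.cor55Incompatibility_of_iota_spaceLink_not_surjective v₀ hv₀ x₀ (L.forget v₀ ⋙ Φ) hΦ),
    L.cor55NotSimCompat_of_iota_spaceLink_not_surjective T v₀ hv₀ x₀ Φ hΦ⟩

/-- Universally quantified form of `cor55NotSimCompat_of_iota_spaceLink_not_surjective`: the criterion's hypothesis does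
not mention the `TS`-datum, so one print-shaped input at an archimedean place gives the second sentence of Cor 5.5 (iv)
at EVERY `TS`-datum of the setting. [cite: MochizukiAbsTopIII2015, Cor 5.5 (iv) p. 131] -/
theorem forall_cor55NotSimCompat_of_iota_spaceLink_not_surjective (v₀ : Vmod) (hv₀ : isArc v₀ = true) (x₀ : L.X)
    (Φ : L.N v₀ ⥤ Type w)
    (hΦ : ∀ (ν : LogVertex (isArc v₀)), ν.isPostLog = false →
      ∀ ε : LogEdge (isArc v₀) ν (LogVertex.spaceLink (isArc v₀)),
        ¬ Function.Surjective (Φ.map ((L.forget v₀).map ((L.iota v₀ ε).app x₀)) : _ → _)) :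
    ∀ T : L.TSHomotopies, L.Cor55NotSimultaneouslyCompatible T :=
  fun T => L.cor55NotSimCompat_of_iota_spaceLink_not_surjective T v₀ hv₀ x₀ Φ hΦ

end LogFrobeniusSetting

/-! ## §3. The setting with genuine archimedean components: the second sentence for EVERY `TS`-datum -/

namespace LogFrobeniusSetting

variable (𝔄 : AutHolFieldFunctor.{u})

/-- **[AbsTopIII] Cor 5.5 (iv), second sentence, HOLDS at the setting with genuine archimedean components for EVERY
`TS`-valued homotopy datum `T`**, over every index set with an archimedean place `v₀` and for every `TF`-pair `x₀`:
"`𝔗_{An•}`, `ℋ_{An•}`, `S_log`, `S_log⊞` are not simultaneously compatible" — by §2 with `Φ :=` the underlying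
arithmetic datum (`HolTHPair.forget`): `k^× ↪ k` misses `0` (`forget_archIota_spaceLink_not_surjective`).  Removes the
`T = archGenuineTS` restriction of `archGenuine_cor55NotSimultaneouslyCompatible_TS`; same binders as the first
sentence's `archGenuine_cor55LogWall`.  MODEL-LEVEL (module docstring). [cite: MochizukiAbsTopIII2015, Cor 5.5 (iv) p. 131] -/
theorem archGenuine_cor55NotSimultaneouslyCompatible (Vmod : Type (u + 1)) (isArc : Vmod → Bool) (v₀ : Vmod)
    (hv₀ : isArc v₀ = true) (x₀ : Up (HolTFPair 𝔄)) (T : (archGenuine 𝔄 Vmod isArc).TSHomotopies) :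
    (archGenuine 𝔄 Vmod isArc).Cor55NotSimultaneouslyCompatible T :=
  (archGenuine 𝔄 Vmod isArc).cor55NotSimCompat_of_iota_spaceLink_not_surjective T v₀ hv₀ x₀
    (inducedFunctor _ ⋙ HolTHPair.forget 𝔄)
    (fun ν _ ε => forget_archIota_spaceLink_not_surjective 𝔄 (isArc v₀) hv₀ ν ε x₀)

/-- **[AbsTopIII] Cor 5.5 (iv), BOTH print-faithful sentences, at the setting with genuine archimedean components, for
EVERY `TS`-datum `T`**: the log-wall "`D•_{≤2}` does not admit a structure of core on `D•_{≤1}` compatible with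
`S_log`, `S_log⊞`" (`Cor55LogWall T`, abc-iut-w4-d095's `archGenuine_cor55LogWall`) and "`𝔗_{An•}`, `ℋ_{An•}`,
`S_log`, `S_log⊞` are not simultaneously compatible" (`Cor55NotSimultaneouslyCompatible T`).  Binders: one archimedean
place, one `TF`-pair; no named fact.  MODEL-LEVEL. [cite: MochizukiAbsTopIII2015, Cor 5.5 (iv) p. 131] -/
theorem archGenuine_cor55iv (Vmod : Type (u + 1)) (isArc : Vmod → Bool) (v₀ : Vmod) (hv₀ : isArc v₀ = true)
    (x₀ : Up (HolTFPair 𝔄)) (T : (archGenuine 𝔄 Vmod isArc).TSHomotopies) :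
    (archGenuine 𝔄 Vmod isArc).Cor55LogWall T ∧ (archGenuine 𝔄 Vmod isArc).Cor55NotSimultaneouslyCompatible T :=
  ⟨archGenuine_cor55LogWall 𝔄 Vmod isArc v₀ hv₀ x₀ T,
    archGenuine_cor55NotSimultaneouslyCompatible 𝔄 Vmod isArc v₀ hv₀ x₀ T⟩

/-- At the setting with genuine archimedean components the `TS`-datum of record `archGenuineTS` and ANY other
`TS`-datum agree at every archimedean place (§1); over an all-archimedean index set `archGenuineTS` is THE datum.
[cite: MochizukiAbsTopIII2015, Def 5.4 (vii) p. 128] -/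
theorem archGenuineTS_eq_of_forall_isArc (Vmod : Type (u + 1)) (isArc : Vmod → Bool)
    (hV : ∀ v : Vmod, isArc v = true) (T : (archGenuine 𝔄 Vmod isArc).TSHomotopies) :
    T = archGenuineTS 𝔄 Vmod isArc :=
  (TSHomotopies.subsingleton_of_forall_isArc (archGenuine 𝔄 Vmod isArc) hV).elim T _

/-- Existence form: over every index set (one universe up) with an archimedean place there is a setting on the
`TF`-pairs which CARRIES a `TS`-datum and at which BOTH sentences of Cor 5.5 (iv) hold for EVERY `TS`-datum — for
every Aut-holomorphic field functor with an elliptically admissible `TF`-pair. [cite: MochizukiAbsTopIII2015, Cor 5.5 (iv) p. 131] -/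
theorem exists_setting_forall_cor55iv (Vmod : Type (u + 1)) (isArc : Vmod → Bool) (v₀ : Vmod)
    (hv₀ : isArc v₀ = true) (P : HolTFPair 𝔄) :
    ∃ L : LogFrobeniusSetting Vmod isArc, L.X = Up (HolTFPair 𝔄) ∧ Nonempty L.TSHomotopies ∧
      ∀ T : L.TSHomotopies, L.Cor55LogWall T ∧ L.Cor55NotSimultaneouslyCompatible T :=
  ⟨archGenuine 𝔄 Vmod isArc, rfl, ⟨archGenuineTS 𝔄 Vmod isArc⟩,
    fun T => archGenuine_cor55iv 𝔄 Vmod isArc v₀ hv₀ (ULift.up P) T⟩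

end LogFrobeniusSetting

end Literature.AnabelianGeometry.AbsoluteAnabelian
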